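import Literature.Barriers.NavierStokesRegularity.NavierStokesInequalityStructureRecipe
import Literature.Barriers.NavierStokesRegularity.NavierStokesInequalityOpLSeparated
import Literature.Barriers.NavierStokesRegularity.NavierStokesInequalitySwirlCalculus
import Literature.Analysis.Calculus.SmoothPlateauProfile
import Mathlib.Analysis.SpecialFunctions.Integrals.Basic
import HarnessLib

/-!
# The field `v₂` of the ring `U₂` (Ożański 2017, Lemma 5.2; Scheffer 1985/1987)

Barrier catalogue support file for `NavierStokesRegularity` (D-0021), on the discharge path of
fact C′ `Literature.Barriers.NavierStokesRegularity.NSICantorArrangementExists` of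
`NavierStokesInequalityCantorArrangement` (and of fact C `NSIArrangementExists`): the solenoidal
planar field `v₂` of the second structure of the geometric arrangement, W. S. Ożański,
arXiv:1709.00602v4, **Lemma 5.2** (held plain-text rendering: Lemma 12), "one of the central
ideas of the proof of Theorem 1": given `d > r > 0` and a small `ε > 0` there is
`v₂ ∈ C_0^∞(P; ℝ²)` with (i) `div(x₂ v₂) = 0`, (ii)
`supp v₂ ⊆ (-d,d) × (0.005εr, r) ∖ [-(d-r), d-r] × [εr, r/10]` (a rectangular ring), (iii)
`|v₂₂| < ε/2`, `-ε² ≤ v₂₁ ≤ 1`, with `v₂₁ ≥ 0`, `v₂₂ = 0` in `[-(d-r), d-r] × (0, εr)`, (iv)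
`v₂ = (1,0)` in `RECT = [-(d-r), d-r] × [0.02εr, 0.98εr]`. Ożański mollifies a piecewise linear
weakly divergence-free field `w` ((5.15)); here the field is written down through an explicit
smooth **stream function** `ψ(r,z) = P(z) Q(r)` (so that `r v = ∇⊥ψ` is automatically
solenoidal), built from the plateau profiles of `Literature.Analysis.Calculus.SmoothPlateauProfile`:
`P` is a plateau in the axial variable (`= 1` for `|z| ≤ d - 0.9 r`, `= 0` for `|z| ≥ d - 0.1 r`)
and `Q(r) = ∫₀ʳ t (θ_b(t) - λ θ_t(t)) dt` with a bottom band profile `θ_b` (`= 1` on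
`[0.02εr, 0.98εr]`, supported in `[0.01εr, 0.99εr]`), a top band profile `θ_t` (`= 1` on
`[0.12r, 0.98r]`, supported in `[0.11r, 0.99r]`) and the flux-matching constant
`λ = ∫tθ_b/∫tθ_t ≤ 1.04 ε²` — the axisymmetric flux balance that makes the return flow
`O(ε²)` slow. The conclusions are Ożański's (i), (ii), (iv) verbatim and (iii) with the constants
`-1.04ε² ≤ v_z ≤ 1` (printed `-ε²`) and `|v_r| ≤ Kε` for an absolute constant `K` (printed
`ε/2`); the consumer (§5.4–§5.5, §6.5 Step 4) only needs `O(ε²)` and `O(ε)` there, the loss in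
the constants being absorbed by the choice of `κ` (see `NavierStokesInequalityCantorArrangement`).

Tree coordinates: `q = (r, z)` (radial first; Ożański's `(x₂, x₁)`), `v = (v_r, v_z)` (his
`(v₂₂, v₂₁)`), `div(r v) = ∂ᵣ(r v_r) + ∂_z(r v_z)` with the Fréchet partials `derivR`, `derivZ`.

## Contents

* `exists_abs_deriv_smoothTransition_le`, `abs_deriv_plateauProfile_le`,
  `deriv_plateauProfile_eq_zero`: derivative bounds for the plateau profiles;
* `weightedMass θ ρ = ∫₀^ρ t θ(t) dt` and its calculus (`FTC`, monotonicity, the two flux bounds);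
* `RingField.P/θb/θt/lam/Θ/Q/field`: the construction, and
* `exists_ringField`: **Lemma 5.2** in the form consumed by the arrangement.

## References

* W. S. Ożański, arXiv:1709.00602v4 (2017/2019), §5.3, Lemma 5.2 (i)–(iv) and its proof
  ((5.15), Fig. 9), §3.5 (the recipe, "stretched geometrically"). [`Ozanski2017NSISingular`]
* V. Scheffer, Comm. Math. Phys. 110 (1987), 525–551, §4 (the fields `g`, (4.20)–(4.31)).
  [`Scheffer1987`]
* V. Scheffer, Comm. Math. Phys. 101 (1985), 47–85, §4. [`Scheffer1985`]
-/

noncomputable section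

open MeasureTheory Set Function Filter Topology Real intervalIntegral
open scoped ContDiff

namespace Literature.Barriers.NavierStokesRegularity

open Literature.Analysis.Calculus

/-! ### Derivative bounds for the transition and plateau profiles -/

/-- **The transition has a bounded derivative**: `∃ K ≥ 0, |S'| ≤ K` (continuous on `[0,1]`,
zero outside; cf. `Literature.Topology.FourManifolds.deriv_smoothTransition_of_neg`). [folklore] -/
theorem exists_abs_deriv_smoothTransition_le :
    ∃ K : ℝ, 0 ≤ K ∧ ∀ x : ℝ, |deriv smoothTransition x| ≤ K := by
  have hc : Continuous (deriv smoothTransition) :=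
    (smoothTransition.contDiff (n := 1)).continuous_deriv le_rfl
  -- the derivative vanishes off `[0,1]`, where the transition is locally constant
  have hneg : ∀ x : ℝ, x < 0 → deriv smoothTransition x = 0 := fun x hx => by
    have h : smoothTransition =ᶠ[𝓝 x] fun _ => (0 : ℝ) := by
      filter_upwards [Iio_mem_nhds hx] with y hy using smoothTransition.zero_of_nonpos hy.le
    rw [h.deriv_eq, deriv_const]
  have hone : ∀ x : ℝ, 1 < x → deriv smoothTransition x = 0 := fun x hx => by
    have h : smoothTransition =ᶠ[𝓝 x] fun _ => (1 : ℝ) := by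
      filter_upwards [Ioi_mem_nhds hx] with y hy using smoothTransition.one_of_one_le hy.le
    rw [h.deriv_eq, deriv_const]
  obtain ⟨K, hK⟩ := isCompact_Icc.exists_bound_of_continuousOn (s := Icc (0 : ℝ) 1) hc.continuousOn
  refine ⟨max K 0, le_max_right _ _, fun x => ?_⟩
  by_cases hx : x ∈ Icc (0 : ℝ) 1
  · exact ((Real.norm_eq_abs _).symm.le.trans (hK x hx)).trans (le_max_left _ _)
  · rw [mem_Icc, not_and_or, not_le, not_le] at hx
    rcases hx with hx | hx
    · rw [hneg x hx, abs_zero]; exact le_max_right _ _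
    · rw [hone x hx, abs_zero]; exact le_max_right _ _

/-- **Derivative of a plateau profile**: `|P'| ≤ 2K/η` if `|S'| ≤ K` (`P = S((x-a)/η) S((b-x)/η)`,
`0 ≤ S ≤ 1`). [folklore] -/
theorem abs_deriv_plateauProfile_le {K : ℝ} (hK : ∀ x, |deriv smoothTransition x| ≤ K) (a b : ℝ)
    {η : ℝ} (hη : 0 < η) (x : ℝ) : |deriv (plateauProfile a b η) x| ≤ 2 * K / η := by
  have hK0 : 0 ≤ K := (abs_nonneg _).trans (hK 0)
  have hS : ContDiff ℝ ∞ smoothTransition := smoothTransition.contDiff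
  have hd₁ : DifferentiableAt ℝ (fun y => smoothTransition ((y - a) / η)) x :=
    ((hS.differentiable (by simp)).comp ((differentiable_id.sub_const a).div_const η)) x
  have hd₂ : DifferentiableAt ℝ (fun y => smoothTransition ((b - y) / η)) x :=
    ((hS.differentiable (by simp)).comp (((differentiable_const b).sub differentiable_id).div_const η)) x
  have hP : plateauProfile a b η = fun y => smoothTransition ((y - a) / η) * smoothTransition ((b - y) / η) :=
    rfl
  rw [hP, deriv_fun_mul hd₁ hd₂]
  rw [show deriv (fun y => smoothTransition ((y - a) / η)) x = η⁻¹ * deriv smoothTransition ((x - a) / η)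
      from congrFun (deriv_comp_affine_left hS a η) x,
    show deriv (fun y => smoothTransition ((b - y) / η)) x = -η⁻¹ * deriv smoothTransition ((b - x) / η)
      from congrFun (deriv_comp_affine_right hS b η) x]
  have h1 : |η⁻¹ * deriv smoothTransition ((x - a) / η) * smoothTransition ((b - x) / η)| ≤ K / η := by
    rw [abs_mul, abs_mul, abs_of_pos (inv_pos.2 hη), abs_of_nonneg (smoothTransition.nonneg _)]
    calc η⁻¹ * |deriv smoothTransition ((x - a) / η)| * smoothTransition ((b - x) / η)
        ≤ η⁻¹ * K * 1 :=
          mul_le_mul (mul_le_mul_of_nonneg_left (hK _) (inv_pos.2 hη).le)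
            (smoothTransition.le_one _) (smoothTransition.nonneg _) (by positivity)
      _ = K / η := by ring
  have h2 : |smoothTransition ((x - a) / η) * (-η⁻¹ * deriv smoothTransition ((b - x) / η))| ≤ K / η := by
    rw [abs_mul, abs_mul, abs_of_nonneg (smoothTransition.nonneg _), abs_neg, abs_of_pos (inv_pos.2 hη)]
    calc smoothTransition ((x - a) / η) * (η⁻¹ * |deriv smoothTransition ((b - x) / η)|)
        ≤ 1 * (η⁻¹ * K) :=
          mul_le_mul (smoothTransition.le_one _) (mul_le_mul_of_nonneg_left (hK _) (inv_pos.2 hη).le)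
            (by positivity) zero_le_one
      _ = K / η := by ring
  calc _ ≤ |η⁻¹ * deriv smoothTransition ((x - a) / η) * smoothTransition ((b - x) / η)| +
        |smoothTransition ((x - a) / η) * (-η⁻¹ * deriv smoothTransition ((b - x) / η))| := abs_add_le _ _
    _ ≤ K / η + K / η := add_le_add h1 h2
    _ = 2 * K / η := by ring

/-- On the interior of the plateau the derivative vanishes. [folklore] -/
theorem deriv_plateauProfile_eq_zero {a b η x : ℝ} (hη : 0 < η) (hx : x ∈ Ioo (a + η) (b - η)) :
    deriv (plateauProfile a b η) x = 0 := by
  have h : plateauProfile a b η =ᶠ[𝓝 x] fun _ => (1 : ℝ) := by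
    filter_upwards [Ioo_mem_nhds hx.1 hx.2] with y hy using
      plateauProfile_eq_one hη ⟨hy.1.le, hy.2.le⟩
  rw [h.deriv_eq, deriv_const]

/-- Off `(a, b)` the derivative of the plateau vanishes. [folklore] -/
theorem deriv_plateauProfile_eq_zero_of_notMem {a b η x : ℝ} (hη : 0 < η) (hx : x ∉ Icc a b) :
    deriv (plateauProfile a b η) x = 0 := by
  rw [mem_Icc, not_and_or, not_le, not_le] at hx
  have h : plateauProfile a b η =ᶠ[𝓝 x] fun _ => (0 : ℝ) := by
    rcases hx with hx | hx
    · filter_upwards [Iio_mem_nhds hx] with y hy using plateauProfile_eq_zero_of_le hη hy.le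
    · filter_upwards [Ioi_mem_nhds hx] with y hy using plateauProfile_eq_zero_of_ge hη hy.le
  rw [h.deriv_eq, deriv_const]

/-- The plateau profile is differentiable. [folklore] -/
theorem differentiable_plateauProfile (a b η : ℝ) : Differentiable ℝ (plateauProfile a b η) :=
  (contDiff_plateauProfile a b η).differentiable (by simp)

/-! ### Weighted masses `∫₀^ρ t θ(t) dt` of a profile -/

/-- The weighted mass `∫₀^ρ t θ(t) dt` (the flux `∫ x₂ v₂₁ dx₂` of an axial flow `v₂₁ = θ`
through the radii `[0, ρ]`). [cite: Ozanski2017NSISingular, §5.1 (Warning 5.1) and Lemma 5.2 (proof)] -/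
def weightedMass (θ : ℝ → ℝ) (ρ : ℝ) : ℝ :=
  ∫ t in (0 : ℝ)..ρ, t * θ t

/-- Unfolding `weightedMass`. [folklore] -/
theorem weightedMass_def (θ : ℝ → ℝ) (ρ : ℝ) : weightedMass θ ρ = ∫ t in (0 : ℝ)..ρ, t * θ t := rfl

section WeightedMass

variable {θ : ℝ → ℝ}

/-- FTC: `(∫₀^ρ tθ)' = ρ θ(ρ)` for continuous `θ`. [folklore] -/
theorem hasDerivAt_weightedMass (hθ : Continuous θ) (ρ : ℝ) :
    HasDerivAt (weightedMass θ) (ρ * θ ρ) ρ :=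
  ((continuous_id.mul hθ).integral_hasStrictDerivAt 0 ρ).hasDerivAt

/-- `deriv (∫₀^ρ tθ) = ρ θ(ρ)`. [folklore] -/
theorem deriv_weightedMass (hθ : Continuous θ) : deriv (weightedMass θ) = fun ρ => ρ * θ ρ :=
  funext fun ρ => (hasDerivAt_weightedMass hθ ρ).deriv

/-- The weighted mass of a smooth profile is smooth. [folklore] -/
theorem contDiff_weightedMass (hθ : ContDiff ℝ ∞ θ) : ContDiff ℝ ∞ (weightedMass θ) := by
  rw [contDiff_infty_iff_deriv, deriv_weightedMass hθ.continuous]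
  exact ⟨fun ρ => (hasDerivAt_weightedMass hθ.continuous ρ).differentiableAt, contDiff_id.mul hθ⟩

/-- Additivity in the endpoint. [folklore] -/
theorem weightedMass_eq_add (hθ : Continuous θ) (ρ₁ ρ₂ : ℝ) :
    weightedMass θ ρ₂ = weightedMass θ ρ₁ + ∫ t in ρ₁..ρ₂, t * θ t := by
  rw [weightedMass, weightedMass, integral_add_adjacent_intervals]
  · exact (continuous_id.mul hθ).intervalIntegrable _ _
  · exact (continuous_id.mul hθ).intervalIntegrable _ _

/-- If `θ` vanishes on `(-∞, a]`, `a ≥ 0`, so does the weighted mass. [folklore] -/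
theorem weightedMass_eq_zero_of_le {a : ℝ} (ha : 0 ≤ a) (h0 : ∀ t ≤ a, θ t = 0)
    {ρ : ℝ} (hρ : ρ ≤ a) : weightedMass θ ρ = 0 := by
  rw [weightedMass]
  refine integral_zero_ae (Eventually.of_forall fun t ht => ?_)
  rcases le_total 0 ρ with h | h
  · rw [uIoc_of_le h] at ht
    rw [h0 t (ht.2.trans hρ), mul_zero]
  · rw [uIoc_of_ge h] at ht
    rw [h0 t (ht.2.trans ha), mul_zero]

/-- The weighted mass of a non-negative profile is non-negative on `ρ ≥ 0`. [folklore] -/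
theorem weightedMass_nonneg (hθ : ∀ t, 0 ≤ θ t) {ρ : ℝ} (hρ : 0 ≤ ρ) : 0 ≤ weightedMass θ ρ :=
  integral_nonneg hρ fun t ht => mul_nonneg ht.1 (hθ t)

/-- The weighted mass of a non-negative profile is monotone on `[0, ∞)`. [folklore] -/
theorem weightedMass_mono (hθc : Continuous θ) (hθ : ∀ t, 0 ≤ θ t) {ρ₁ ρ₂ : ℝ} (h₁ : 0 ≤ ρ₁)
    (h₁₂ : ρ₁ ≤ ρ₂) : weightedMass θ ρ₁ ≤ weightedMass θ ρ₂ := by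
  rw [weightedMass_eq_add hθc ρ₁ ρ₂]
  have : 0 ≤ ∫ t in ρ₁..ρ₂, t * θ t :=
    integral_nonneg h₁₂ fun t ht => mul_nonneg (h₁.trans ht.1) (hθ t)
  linarith

/-- Beyond the support the weighted mass is constant: if `θ = 0` on `[b, ∞)` then
`∫₀^ρ tθ = ∫₀^b tθ` for `ρ ≥ b`. [folklore] -/
theorem weightedMass_eq_of_ge (hθc : Continuous θ) {b : ℝ} (h0 : ∀ t, b ≤ t → θ t = 0) {ρ : ℝ}
    (hρ : b ≤ ρ) : weightedMass θ ρ = weightedMass θ b := by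
  rw [weightedMass_eq_add hθc b ρ]
  have : ∫ t in b..ρ, t * θ t = 0 := by
    refine integral_zero_ae (Eventually.of_forall fun t ht => ?_)
    rw [uIoc_of_le hρ] at ht
    rw [h0 t ht.1.le, mul_zero]
  rw [this, add_zero]

end WeightedMass

/-! ### Weighted masses of plateau profiles: the two flux bounds -/

section PlateauMass

variable {a b η : ℝ}

/-- The weighted mass of a plateau supported in `[a,b]`, `a ≥ 0`, vanishes for `ρ ≤ a`.
[folklore] -/
theorem weightedMass_plateau_eq_zero (hη : 0 < η) (ha : 0 ≤ a) {ρ : ℝ} (hρ : ρ ≤ a) :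
    weightedMass (plateauProfile a b η) ρ = 0 :=
  weightedMass_eq_zero_of_le ha (fun _ ht => plateauProfile_eq_zero_of_le hη ht) hρ

/-- … and is constant for `ρ ≥ b`. [folklore] -/
theorem weightedMass_plateau_eq_total (hη : 0 < η) {ρ : ℝ} (hρ : b ≤ ρ) :
    weightedMass (plateauProfile a b η) ρ = weightedMass (plateauProfile a b η) b :=
  weightedMass_eq_of_ge (contDiff_plateauProfile a b η).continuous
    (fun _ ht => plateauProfile_eq_zero_of_ge hη ht) hρ

/-- `0 ≤ ∫₀^ρ tθ` for a plateau with `a ≥ 0` (all `ρ`). [folklore] -/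
theorem weightedMass_plateau_nonneg (hη : 0 < η) (ha : 0 ≤ a) (ρ : ℝ) :
    0 ≤ weightedMass (plateauProfile a b η) ρ := by
  rcases le_total ρ a with h | h
  · rw [weightedMass_plateau_eq_zero hη ha h]
  · exact weightedMass_nonneg (plateauProfile_nonneg a b η) (ha.trans h)

/-- `∫₀^ρ tθ ≤ ∫₀^b tθ` (the total flux) for a plateau with `a ≥ 0` (all `ρ`). [folklore] -/
theorem weightedMass_plateau_le_total (hη : 0 < η) (ha : 0 ≤ a) (ρ : ℝ) :
    weightedMass (plateauProfile a b η) ρ ≤ weightedMass (plateauProfile a b η) b := by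
  rcases le_total ρ a with h | h
  · rw [weightedMass_plateau_eq_zero hη ha h]
    exact weightedMass_plateau_nonneg hη ha b
  · rcases le_total ρ b with h' | h'
    · exact weightedMass_mono (contDiff_plateauProfile a b η).continuous (plateauProfile_nonneg a b η)
        (ha.trans h) h'
    · rw [weightedMass_plateau_eq_total hη h']

/-- **Upper flux bound**: `∫₀^b tθ ≤ (b² - a²)/2` for a plateau supported in `[a,b]`, `0 ≤ a ≤ b`
(`θ ≤ 1`). [folklore] -/
theorem weightedMass_plateau_total_le (hη : 0 < η) (ha : 0 ≤ a) (hab : a ≤ b) :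
    weightedMass (plateauProfile a b η) b ≤ (b ^ 2 - a ^ 2) / 2 := by
  have hc := (contDiff_plateauProfile a b η).continuous
  rw [weightedMass_eq_add hc a b, weightedMass_plateau_eq_zero hη ha le_rfl, zero_add, ← integral_id]
  refine integral_mono_on hab ((continuous_id.mul hc).intervalIntegrable _ _)
    intervalIntegrable_id fun t ht => ?_
  calc t * plateauProfile a b η t ≤ t * 1 :=
        mul_le_mul_of_nonneg_left (plateauProfile_le_one a b η t) (ha.trans ht.1)
    _ = t := mul_one t

/-- **Lower flux bound**: `∫₀^b tθ ≥ ((b-η)² - (a+η)²)/2` for a plateau equal to `1` on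
`[a+η, b-η]` (`0 ≤ a`, `a + η ≤ b - η`). [folklore] -/
theorem le_weightedMass_plateau_total (hη : 0 < η) (ha : 0 ≤ a) (hab : a + η ≤ b - η) :
    ((b - η) ^ 2 - (a + η) ^ 2) / 2 ≤ weightedMass (plateauProfile a b η) b := by
  have hc := (contDiff_plateauProfile a b η).continuous
  have hnn := plateauProfile_nonneg a b η
  have h1 : 0 ≤ weightedMass (plateauProfile a b η) (a + η) :=
    weightedMass_nonneg hnn (by linarith)
  have h2 : ∫ t in (a + η)..(b - η), t * plateauProfile a b η t = ((b - η) ^ 2 - (a + η) ^ 2) / 2 := by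
    rw [← integral_id]
    refine integral_congr fun t ht => ?_
    rw [uIcc_of_le hab] at ht
    simp only [plateauProfile_eq_one hη ht, mul_one]
  have h3 : 0 ≤ ∫ t in (b - η)..b, t * plateauProfile a b η t :=
    integral_nonneg (by linarith) fun t ht => mul_nonneg (by linarith [ht.1]) (hnn t)
  rw [weightedMass_eq_add hc (b - η) b, weightedMass_eq_add hc (a + η) (b - η), h2]
  linarith

end PlateauMass


/-! ### The construction -/

namespace RingField

/-- The axial plateau `P(z)`: `= 1` for `|z| ≤ d - 0.9r`, `= 0` for `|z| ≥ d - 0.1r`, transition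
width `0.8 r` (the axial extent of Ożański's regions `R₂`, `R₄` is `r`).
[cite: Ozanski2017NSISingular, Lemma 5.2 (proof, Fig. 9)] -/
def P (r d : ℝ) : ℝ → ℝ :=
  plateauProfile (-d + r / 10) (d - r / 10) (4 * r / 5)

/-- The bottom band profile `θ_b(ρ)`: `= 1` on `[0.02εr, 0.98εr]`, supported in `[0.01εr, 0.99εr]`
(Ożański's region `R₁`, where `v₂ = (1,0)`). [cite: Ozanski2017NSISingular, Lemma 5.2 (iv)] -/
def θb (ε r : ℝ) : ℝ → ℝ :=
  plateauProfile (ε * r / 100) (99 * ε * r / 100) (ε * r / 100)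

/-- The top band profile `θ_t(ρ)`: `= 1` on `[0.12r, 0.98r]`, supported in `[0.11r, 0.99r]`
(Ożański's return region `R₃`, where `v₂ = -ε²(1,0)`). [cite: Ozanski2017NSISingular, Lemma 5.2 (proof, (5.15))] -/
def θt (r : ℝ) : ℝ → ℝ :=
  plateauProfile (11 * r / 100) (99 * r / 100) (r / 100)

/-- The bottom flux `c_b = ∫ t θ_b(t) dt`. [cite: Ozanski2017NSISingular, Lemma 5.2 (proof)] -/
def cb (ε r : ℝ) : ℝ :=
  weightedMass (θb ε r) (99 * ε * r / 100)

/-- The top flux capacity `c_t = ∫ t θ_t(t) dt`. [cite: Ozanski2017NSISingular, Lemma 5.2 (proof)] -/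
def ct (r : ℝ) : ℝ :=
  weightedMass (θt r) (99 * r / 100)

/-- The flux-matching constant `λ = c_b/c_t` (the speed of the return flow; `≈ ε²`).
[cite: Ozanski2017NSISingular, Lemma 5.2 (iii)] -/
def lam (ε r : ℝ) : ℝ :=
  cb ε r / ct r

/-- The radial profile of the axial velocity on the plateau of `P`: `g = θ_b - λ θ_t`.
[cite: Ozanski2017NSISingular, Lemma 5.2 (proof, (5.15))] -/
def g (ε r : ℝ) (t : ℝ) : ℝ :=
  θb ε r t - lam ε r * θt r t

/-- The radial factor of the stream function: `Q(ρ) = ∫₀^ρ t g(t) dt`. [cite: Ozanski2017NSISingular, Lemma 5.2 (proof)] -/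
def Q (ε r : ℝ) : ℝ → ℝ :=
  weightedMass (g ε r)

/-- **The field `v₂`** of Lemma 5.2, `r v₂ = ∇⊥(P(z)Q(r))`:
`v₂(r,z) = (-P'(z) Q(r)/r, P(z) g(r))` (radial, axial components).
[cite: Ozanski2017NSISingular, Lemma 5.2] -/
def field (ε r d : ℝ) (q : ℝ × ℝ) : ℝ × ℝ :=
  (-deriv (P r d) q.2 * (Q ε r q.1 * q.1⁻¹), P r d q.2 * g ε r q.1)

section Estimates

variable {ε r d : ℝ}

/-! #### The constants -/

/-- `c_b ≤ 0.49 ε² r²`. [folklore] -/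
theorem cb_le (hε : 0 < ε) (hr : 0 < r) : cb ε r ≤ 49 / 100 * (ε ^ 2 * r ^ 2) := by
  have h := weightedMass_plateau_total_le (a := ε * r / 100) (b := 99 * ε * r / 100)
    (η := ε * r / 100) (by positivity) (by positivity) (by nlinarith [mul_pos hε hr])
  rw [cb]
  refine h.trans (le_of_eq ?_)
  ring

/-- `0 ≤ c_b`. [folklore] -/
theorem cb_nonneg (hε : 0 < ε) (hr : 0 < r) : 0 ≤ cb ε r :=
  weightedMass_plateau_nonneg (by positivity) (by positivity) _

/-- `c_t ≥ 0.473 r²`. [folklore] -/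
theorem le_ct (hr : 0 < r) : 473 / 1000 * r ^ 2 ≤ ct r := by
  have h := le_weightedMass_plateau_total (a := 11 * r / 100) (b := 99 * r / 100) (η := r / 100)
    (by positivity) (by positivity) (by nlinarith)
  rw [ct]
  refine (le_of_eq ?_).trans h
  ring

/-- `0 < c_t`. [folklore] -/
theorem ct_pos (hr : 0 < r) : 0 < ct r :=
  lt_of_lt_of_le (by positivity) (le_ct hr)

/-- `0 ≤ λ`. [folklore] -/
theorem lam_nonneg (hε : 0 < ε) (hr : 0 < r) : 0 ≤ lam ε r :=
  div_nonneg (cb_nonneg hε hr) (ct_pos hr).le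

/-- **`λ ≤ 1.04 ε²`**: the return flow is `O(ε²)` slow (Ożański's `v₂₁ = -ε²` in `R₃`).
[cite: Ozanski2017NSISingular, Lemma 5.2 (iii)] -/
theorem lam_le (hε : 0 < ε) (hr : 0 < r) : lam ε r ≤ 104 / 100 * ε ^ 2 := by
  rw [lam, div_le_iff₀ (ct_pos hr)]
  have h1 := cb_le hε hr
  have h2 := le_ct hr
  nlinarith [sq_nonneg ε, sq_nonneg r, mul_pos (pow_pos hε 2) (pow_pos hr 2)]

/-- `λ c_t = c_b` (flux matching). [folklore] -/
theorem lam_mul_ct (hr : 0 < r) : lam ε r * ct r = cb ε r := by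
  rw [lam, div_mul_cancel₀ _ (ct_pos hr).ne']

/-! #### The profiles -/

/-- `P` is smooth. [folklore] -/
theorem contDiff_P : ContDiff ℝ ∞ (P r d) := contDiff_plateauProfile _ _ _
/-- `θ_b` is smooth. [folklore] -/
theorem contDiff_θb : ContDiff ℝ ∞ (θb ε r) := contDiff_plateauProfile _ _ _
/-- `θ_t` is smooth. [folklore] -/
theorem contDiff_θt : ContDiff ℝ ∞ (θt r) := contDiff_plateauProfile _ _ _
/-- `g` is smooth. [folklore] -/
theorem contDiff_g : ContDiff ℝ ∞ (g ε r) := contDiff_θb.sub (contDiff_const.mul contDiff_θt)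
/-- `Q` is smooth. [folklore] -/
theorem contDiff_Q : ContDiff ℝ ∞ (Q ε r) := contDiff_weightedMass contDiff_g

/-- `0 ≤ P ≤ 1`. [folklore] -/
theorem P_mem (z : ℝ) : P r d z ∈ Icc (0 : ℝ) 1 := ⟨plateauProfile_nonneg _ _ _ _, plateauProfile_le_one _ _ _ _⟩
/-- `0 ≤ θ_b ≤ 1`. [folklore] -/
theorem θb_mem (t : ℝ) : θb ε r t ∈ Icc (0 : ℝ) 1 := ⟨plateauProfile_nonneg _ _ _ _, plateauProfile_le_one _ _ _ _⟩
/-- `0 ≤ θ_t ≤ 1`. [folklore] -/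
theorem θt_mem (t : ℝ) : θt r t ∈ Icc (0 : ℝ) 1 := ⟨plateauProfile_nonneg _ _ _ _, plateauProfile_le_one _ _ _ _⟩

/-- `P = 1` for `|z| < d - 0.9 r`, in the strong form `P' = 0` and `P = 1` there. [folklore] -/
theorem P_eq_one (hr : 0 < r) {z : ℝ} (hz : |z| ≤ d - r) : P r d z = 1 :=
  plateauProfile_eq_one (by positivity) ⟨by linarith [(abs_le.1 hz).1], by linarith [(abs_le.1 hz).2]⟩

/-- `P' = 0` for `|z| ≤ d - r`. [folklore] -/
theorem deriv_P_eq_zero (hr : 0 < r) {z : ℝ} (hz : |z| ≤ d - r) : deriv (P r d) z = 0 :=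
  deriv_plateauProfile_eq_zero (by positivity) ⟨by linarith [(abs_le.1 hz).1], by linarith [(abs_le.1 hz).2]⟩

/-- `|P'| ≤ 2.5 K/r` for a derivative bound `K` of the transition. [folklore] -/
theorem abs_deriv_P_le {K : ℝ} (hK : ∀ x, |deriv smoothTransition x| ≤ K) (hr : 0 < r) (z : ℝ) :
    |deriv (P r d) z| ≤ 5 / 2 * K / r := by
  refine (abs_deriv_plateauProfile_le hK _ _ (by positivity : (0 : ℝ) < 4 * r / 5) z).trans (le_of_eq ?_)
  field_simp
  ring

/-- `θ_t = 0` below `0.11 r`. [folklore] -/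
theorem θt_eq_zero (hr : 0 < r) {t : ℝ} (ht : t ≤ 11 * r / 100) : θt r t = 0 :=
  plateauProfile_eq_zero_of_le (η := r / 100) (by positivity) ht

/-- `θ_b = 0` below `0.01 ε r`. [folklore] -/
theorem θb_eq_zero (hε : 0 < ε) (hr : 0 < r) {t : ℝ} (ht : t ≤ ε * r / 100) : θb ε r t = 0 :=
  plateauProfile_eq_zero_of_le (η := ε * r / 100) (by positivity) ht

/-- `θ_b = 0` above `0.99 ε r`. [folklore] -/
theorem θb_eq_zero_of_ge (hε : 0 < ε) (hr : 0 < r) {t : ℝ} (ht : 99 * ε * r / 100 ≤ t) : θb ε r t = 0 :=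
  plateauProfile_eq_zero_of_ge (η := ε * r / 100) (by positivity) ht

/-- `θ_t = 0` above `0.99 r`. [folklore] -/
theorem θt_eq_zero_of_ge (hr : 0 < r) {t : ℝ} (ht : 99 * r / 100 ≤ t) : θt r t = 0 :=
  plateauProfile_eq_zero_of_ge (η := r / 100) (by positivity) ht

/-- `θ_b = 1` on `[0.02εr, 0.98εr]`. [folklore] -/
theorem θb_eq_one (hε : 0 < ε) (hr : 0 < r) {t : ℝ} (ht : t ∈ Icc (2 * ε * r / 100) (98 * ε * r / 100)) :
    θb ε r t = 1 :=
  plateauProfile_eq_one (η := ε * r / 100) (by positivity) ⟨by linarith [ht.1], by linarith [ht.2]⟩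

/-- `g = 0` on `(-∞, 0.01εr]`. [folklore] -/
theorem g_eq_zero (hε : 0 < ε) (hε' : ε ≤ 1 / 20) (hr : 0 < r) {t : ℝ} (ht : t ≤ ε * r / 100) :
    g ε r t = 0 := by
  have h1 : t ≤ 11 * r / 100 := ht.trans (by nlinarith)
  simp [g, θb_eq_zero hε hr ht, θt_eq_zero hr h1]

/-! #### The radial factor `Q` -/

/-- `Q = ∫₀ t θ_b - λ ∫₀ t θ_t`. [folklore] -/
theorem Q_eq (ρ : ℝ) : Q ε r ρ = weightedMass (θb ε r) ρ - lam ε r * weightedMass (θt r) ρ := by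
  have hb : Continuous fun t : ℝ => t * θb ε r t := continuous_id.mul contDiff_θb.continuous
  have ht : Continuous fun t : ℝ => lam ε r * (t * θt r t) :=
    continuous_const.mul (continuous_id.mul contDiff_θt.continuous)
  have h1 : (fun t : ℝ => t * g ε r t) = fun t => t * θb ε r t - lam ε r * (t * θt r t) := by
    funext t; simp only [g]; ring
  simp only [Q, weightedMass, h1]
  rw [intervalIntegral.integral_sub (hb.intervalIntegrable _ _) (ht.intervalIntegrable _ _),
    intervalIntegral.integral_const_mul]

/-- The bottom flux is complete above the bottom band. [folklore] -/
theorem weightedMass_θb_eq_cb (hε : 0 < ε) (hr : 0 < r) {ρ : ℝ} (hρ : 99 * ε * r / 100 ≤ ρ) :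
    weightedMass (θb ε r) ρ = cb ε r :=
  weightedMass_plateau_eq_total (η := ε * r / 100) (by positivity) hρ

/-- The top flux is complete above the top band. [folklore] -/
theorem weightedMass_θt_eq_ct (hr : 0 < r) {ρ : ℝ} (hρ : 99 * r / 100 ≤ ρ) :
    weightedMass (θt r) ρ = ct r :=
  weightedMass_plateau_eq_total (η := r / 100) (by positivity) hρ

/-- No top flux below the top band. [folklore] -/
theorem weightedMass_θt_eq_zero (hr : 0 < r) {ρ : ℝ} (hρ : ρ ≤ 11 * r / 100) :
    weightedMass (θt r) ρ = 0 :=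
  weightedMass_plateau_eq_zero (η := r / 100) (b := 99 * r / 100) (by positivity) (by positivity) hρ

/-- `0 ≤ ∫₀^ρ tθ_b ≤ c_b`. [folklore] -/
theorem weightedMass_θb_mem (hε : 0 < ε) (hr : 0 < r) (ρ : ℝ) :
    weightedMass (θb ε r) ρ ∈ Icc 0 (cb ε r) :=
  ⟨weightedMass_plateau_nonneg (η := ε * r / 100) (b := 99 * ε * r / 100) (by positivity)
      (by positivity) ρ,
    weightedMass_plateau_le_total (η := ε * r / 100) (b := 99 * ε * r / 100) (by positivity)
      (by positivity) ρ⟩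

/-- `0 ≤ ∫₀^ρ tθ_t ≤ c_t`. [folklore] -/
theorem weightedMass_θt_mem (hr : 0 < r) (ρ : ℝ) : weightedMass (θt r) ρ ∈ Icc 0 (ct r) :=
  ⟨weightedMass_plateau_nonneg (η := r / 100) (b := 99 * r / 100) (by positivity) (by positivity) ρ,
    weightedMass_plateau_le_total (η := r / 100) (b := 99 * r / 100) (by positivity) (by positivity) ρ⟩

/-- `Q = 0` on `(-∞, 0.01εr]`. [folklore] -/
theorem Q_eq_zero_of_le (hε : 0 < ε) (hε' : ε ≤ 1 / 20) (hr : 0 < r) {ρ : ℝ} (hρ : ρ ≤ ε * r / 100) :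
    Q ε r ρ = 0 :=
  weightedMass_eq_zero_of_le (a := ε * r / 100) (by positivity) (fun _ ht => g_eq_zero hε hε' hr ht) hρ

/-- `Q = 0` on `[0.99 r, ∞)` (the fluxes match: `c_b = λ c_t`). [folklore] -/
theorem Q_eq_zero_of_ge (hε : 0 < ε) (hε' : ε ≤ 1 / 20) (hr : 0 < r) {ρ : ℝ} (hρ : 99 * r / 100 ≤ ρ) :
    Q ε r ρ = 0 := by
  have hb : 99 * ε * r / 100 ≤ ρ := hρ.trans' (by nlinarith)
  rw [Q_eq, weightedMass_θb_eq_cb hε hr hb, weightedMass_θt_eq_ct hr hρ, lam_mul_ct hr, sub_self]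

/-- `0 ≤ Q ≤ c_b`. [folklore] -/
theorem Q_mem (hε : 0 < ε) (hε' : ε ≤ 1 / 20) (hr : 0 < r) (ρ : ℝ) : Q ε r ρ ∈ Icc 0 (cb ε r) := by
  have hl := lam_nonneg hε hr
  have hWb := weightedMass_θb_mem hε hr ρ
  have hWt := weightedMass_θt_mem hr ρ
  rw [Q_eq]
  constructor
  · rcases le_total ρ (11 * r / 100) with h | h
    · -- below the top band the return term vanishes
      rw [weightedMass_θt_eq_zero hr h, mul_zero, sub_zero]
      exact hWb.1
    · -- above the bottom band the forward flux is complete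
      have hb : 99 * ε * r / 100 ≤ ρ := h.trans' (by nlinarith)
      rw [weightedMass_θb_eq_cb hε hr hb, ← lam_mul_ct hr]
      nlinarith [hWt.2]
  · nlinarith [hWb.2, hWt.1]

/-- `|Q/ρ| ≤ 49 ε r` (it vanishes for `ρ ≤ 0.01εr` and `Q ≤ c_b ≤ 0.49ε²r²` beyond). [folklore] -/
theorem abs_Q_mul_inv_le (hε : 0 < ε) (hε' : ε ≤ 1 / 20) (hr : 0 < r) (ρ : ℝ) :
    |Q ε r ρ * ρ⁻¹| ≤ 49 * (ε * r) := by
  rcases le_or_gt ρ (ε * r / 100) with h | h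
  · rw [Q_eq_zero_of_le hε hε' hr h, zero_mul, abs_zero]; positivity
  · have hρ : 0 < ρ := lt_trans (by positivity) h
    have hQ := Q_mem hε hε' hr ρ
    rw [abs_mul, abs_of_nonneg hQ.1, abs_of_pos (inv_pos.2 hρ), ← div_eq_mul_inv, div_le_iff₀ hρ]
    have := cb_le hε hr
    nlinarith [hQ.2, mul_pos hε hr]

/-! #### The field: smoothness, solenoidality, support -/

/-- `Q(r)/r` is smooth on the plane (it vanishes near the axis). [folklore] -/
theorem contDiff_Q_mul_inv (hε : 0 < ε) (hε' : ε ≤ 1 / 20) (hr : 0 < r) :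
    ContDiff ℝ ∞ fun q : ℝ × ℝ => Q ε r q.1 * q.1⁻¹ :=
  contDiff_mul_inv_fst_of_eq_zero (g := fun q : ℝ × ℝ => Q ε r q.1) (contDiff_Q.comp contDiff_fst)
    (by positivity : (0 : ℝ) < ε * r / 100) fun q hq => Q_eq_zero_of_le hε hε' hr hq.le

/-- **`v₂ ∈ C^∞(ℝ²; ℝ²)`**. [cite: Ozanski2017NSISingular, Lemma 5.2] -/
theorem contDiff_field (hε : 0 < ε) (hε' : ε ≤ 1 / 20) (hr : 0 < r) : ContDiff ℝ ∞ (field ε r d) := by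
  have hP' : ContDiff ℝ ∞ (deriv (P r d)) := (contDiff_infty_iff_deriv.1 contDiff_P).2
  refine ContDiff.prodMk ?_ ?_
  · exact ((hP'.comp contDiff_snd).neg).mul (contDiff_Q_mul_inv hε hε' hr)
  · exact (contDiff_P.comp contDiff_snd).mul (contDiff_g.comp contDiff_fst)

/-- `r v_r = -P'(z) Q(r)` everywhere (also on the axis, where both sides vanish). [folklore] -/
theorem fst_mul_field_fst (hε : 0 < ε) (hε' : ε ≤ 1 / 20) (hr : 0 < r) :
    (fun q : ℝ × ℝ => q.1 * (field ε r d q).1) = fun q => Q ε r q.1 * (-deriv (P r d) q.2) := by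
  funext q
  simp only [field]
  rcases eq_or_ne q.1 0 with h0 | h0
  · rw [h0, Q_eq_zero_of_le hε hε' hr (by positivity)]
    simp
  · field_simp

/-- `r v_z = (r g(r)) P(z)`. [folklore] -/
theorem fst_mul_field_snd : (fun q : ℝ × ℝ => q.1 * (field ε r d q).2) = fun q => (q.1 * g ε r q.1) * P r d q.2 := by
  funext q; simp only [field]; ring

/-- **(i) `div(r v₂) = 0`** everywhere: `∂ᵣ(r v_r) + ∂_z(r v_z) = -Q'(r)P'(z) + (r g(r)) P'(z) = 0`
since `Q' = r g`. [cite: Ozanski2017NSISingular, Lemma 5.2 (i)] -/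
theorem div_field (hε : 0 < ε) (hε' : ε ≤ 1 / 20) (hr : 0 < r) (q : ℝ × ℝ) :
    derivR (fun q' : ℝ × ℝ => q'.1 * (field ε r d q').1) q +
      derivZ (fun q' : ℝ × ℝ => q'.1 * (field ε r d q').2) q = 0 := by
  have hQ : Differentiable ℝ (Q ε r) := contDiff_Q.differentiable (by simp)
  have hP : Differentiable ℝ (P r d) := contDiff_P.differentiable (by simp)
  have hP' : Differentiable ℝ (fun z => -deriv (P r d) z) :=
    ((contDiff_infty_iff_deriv.1 (contDiff_P (r := r) (d := d))).2.differentiable (by simp)).neg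
  have hG : Differentiable ℝ (fun t => t * g ε r t) :=
    differentiable_id.mul (contDiff_g.differentiable (by simp))
  rw [fst_mul_field_fst hε hε' hr, fst_mul_field_snd, derivR_mul_sep hQ hP', derivZ_mul_sep hG hP]
  have hdQ : deriv (Q ε r) q.1 = q.1 * g ε r q.1 :=
    congrFun (deriv_weightedMass contDiff_g.continuous) q.1
  simp only [hdQ]
  ring

/-- The closed set `S` carrying the support of `v₂`: the two ends `[0.01εr, 0.99r] × {d-0.9r ≤ |z| ≤ d-0.1r}`
and the two bands `([0.01εr, 0.99εr] ∪ [0.11r, 0.99r]) × [-(d-0.1r), d-0.1r]`. [folklore] -/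
def carrier (ε r d : ℝ) : Set (ℝ × ℝ) :=
  Icc (ε * r / 100) (99 * r / 100) ×ˢ {z : ℝ | d - 9 * r / 10 ≤ |z| ∧ |z| ≤ d - r / 10} ∪
    (Icc (ε * r / 100) (99 * ε * r / 100) ∪ Icc (11 * r / 100) (99 * r / 100)) ×ˢ
      Icc (-d + r / 10) (d - r / 10)

/-- `S` is closed. [folklore] -/
theorem isClosed_carrier : IsClosed (carrier ε r d) := by
  refine (isClosed_Icc.prod ?_).union ((isClosed_Icc.union isClosed_Icc).prod isClosed_Icc)
  exact (isClosed_le continuous_const continuous_abs).inter (isClosed_le continuous_abs continuous_const)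

/-- `supp v₂ ⊆ S`. [folklore] -/
theorem field_ne_zero_subset (hε : 0 < ε) (hε' : ε ≤ 1 / 20) (hr : 0 < r) {q : ℝ × ℝ}
    (hq : field ε r d q ≠ 0) : q ∈ carrier ε r d := by
  have hηP : (0 : ℝ) < 4 * r / 5 := by positivity
  rw [Ne, Prod.ext_iff, not_and_or] at hq
  simp only [field, Prod.fst_zero, Prod.snd_zero] at hq
  rcases hq with h1 | h2
  · -- the radial component is non-zero: an end region
    left
    have hP' : deriv (P r d) q.2 ≠ 0 := fun h => h1 (by simp [h])
    have hQ : Q ε r q.1 ≠ 0 := fun h => h1 (by simp [h])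
    refine ⟨⟨?_, ?_⟩, ?_, ?_⟩
    · by_contra h; exact hQ (Q_eq_zero_of_le hε hε' hr (not_le.1 h).le)
    · by_contra h; exact hQ (Q_eq_zero_of_ge hε hε' hr (not_le.1 h).le)
    · by_contra h
      have h' := not_le.1 h
      refine hP' (deriv_plateauProfile_eq_zero hηP ⟨?_, ?_⟩)
      · have := neg_abs_le q.2; linarith
      · have := le_abs_self q.2; linarith
    · by_contra h
      have h' := not_le.1 h
      refine hP' (deriv_plateauProfile_eq_zero_of_notMem hηP fun hm => ?_)
      have h'' : |q.2| ≤ d - r / 10 := abs_le.2 ⟨by linarith [hm.1], hm.2⟩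
      linarith
  · -- the axial component is non-zero: a band
    right
    have hP : P r d q.2 ≠ 0 := fun h => h2 (by simp [h])
    have hg : g ε r q.1 ≠ 0 := fun h => h2 (by simp [h])
    refine ⟨?_, ?_⟩
    · by_contra hn
      simp only [mem_union, mem_Icc, not_or, not_and_or, not_le] at hn
      apply hg
      simp only [g]
      rcases hn.1 with h | h
      · rw [θb_eq_zero hε hr h.le, θt_eq_zero hr (h.le.trans (by nlinarith)), mul_zero, sub_zero]
      · rw [θb_eq_zero_of_ge hε hr h.le]
        rcases hn.2 with h' | h'
        · rw [θt_eq_zero hr h'.le, mul_zero, sub_zero]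
        · rw [θt_eq_zero_of_ge hr h'.le, mul_zero, sub_zero]
    · have := support_plateauProfile (a := -d + r / 10) (b := d - r / 10) hηP
      have hm : q.2 ∈ Function.support (P r d) := hP
      rw [P, this] at hm
      exact ⟨hm.1.le, hm.2.le⟩

/-- `tsupport v₂ ⊆ S`. [folklore] -/
theorem tsupport_field_subset_carrier (hε : 0 < ε) (hε' : ε ≤ 1 / 20) (hr : 0 < r) :
    tsupport (field ε r d) ⊆ carrier ε r d :=
  closure_minimal (fun _ hq => field_ne_zero_subset hε hε' hr hq) isClosed_carrier

/-- **(ii) `supp v₂ ⊆ (-d,d) × (0.005εr, r) ∖ [-(d-r), d-r] × [εr, r/10]`** (Ożański's order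
`(x₁, x₂)`; here radial first: `rect (εr/200) r (-d) d ∖ crect (εr) (r/10) (-(d-r)) (d-r)`).
[cite: Ozanski2017NSISingular, Lemma 5.2 (ii)] -/
theorem tsupport_field_subset (hε : 0 < ε) (hε' : ε ≤ 1 / 20) (hr : 0 < r) :
    tsupport (field ε r d) ⊆
      rect (ε * r / 200) r (-d) d \ crect (ε * r) (r / 10) (-(d - r)) (d - r) := by
  refine (tsupport_field_subset_carrier hε hε' hr).trans ?_
  have hεr : 0 < ε * r := mul_pos hε hr
  rintro ⟨ρ, z⟩ hq
  simp only [carrier, mem_union, mem_prod, mem_Icc, mem_setOf_eq] at hq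
  simp only [Set.mem_sdiff, mem_rect, mem_crect, not_and_or, not_le]
  rcases hq with ⟨⟨h1, h2⟩, h3, h4⟩ | ⟨hρ, hz1, hz2⟩
  · have hz := abs_le.1 h4
    refine ⟨⟨⟨by linarith, by linarith⟩, by linarith, by linarith⟩, ?_⟩
    right
    -- `|z| ≥ d - 0.9 r > d - r`
    rcases le_or_gt 0 z with hz0 | hz0
    · rw [abs_of_nonneg hz0] at h3; right; linarith
    · rw [abs_of_neg hz0] at h3; left; linarith
  · refine ⟨⟨?_, by linarith, by linarith⟩, ?_⟩
    · rcases hρ with ⟨h1, h2⟩ | ⟨h1, h2⟩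
      · exact ⟨by linarith, by nlinarith⟩
      · exact ⟨by nlinarith, by linarith⟩
    · left
      rcases hρ with ⟨h1, h2⟩ | ⟨h1, h2⟩
      · left; nlinarith
      · right; linarith

/-! #### The field: values and bounds -/

/-- **(iv) `v₂ = (1,0)` on `RECT`** (unit axial flow for `|z| ≤ d - r`, `0.02εr ≤ ρ ≤ 0.98εr`).
[cite: Ozanski2017NSISingular, Lemma 5.2 (iv)] -/
theorem field_eq_of_mem_rect (hε : 0 < ε) (hε' : ε ≤ 1 / 20) (hr : 0 < r) {q : ℝ × ℝ}
    (hz : |q.2| ≤ d - r) (hρ : q.1 ∈ Icc (2 * ε * r / 100) (98 * ε * r / 100)) :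
    field ε r d q = (0, 1) := by
  have ht : θt r q.1 = 0 := θt_eq_zero hr (hρ.2.trans (by nlinarith))
  simp only [field, deriv_P_eq_zero hr hz, P_eq_one hr hz, g, θb_eq_one hε hr hρ, ht]
  simp

/-- **(iii), second half: `v_r = 0` for `|z| ≤ d - r`** (printed on `[-(d-r), d-r] × (0, εr)`).
[cite: Ozanski2017NSISingular, Lemma 5.2 (iii)] -/
theorem field_fst_eq_zero (hr : 0 < r) {q : ℝ × ℝ} (hz : |q.2| ≤ d - r) : (field ε r d q).1 = 0 := by
  simp [field, deriv_P_eq_zero hr hz]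

/-- **(iii), second half: `v_z ≥ 0` below the top band** (`ρ ≤ 0.11 r`; printed on
`[-(d-r), d-r] × (0, εr)`). [cite: Ozanski2017NSISingular, Lemma 5.2 (iii)] -/
theorem field_snd_nonneg (hr : 0 < r) {q : ℝ × ℝ} (hρ : q.1 ≤ 11 * r / 100) : 0 ≤ (field ε r d q).2 := by
  simp only [field, g, θt_eq_zero hr hρ, mul_zero, sub_zero]
  exact mul_nonneg (P_mem q.2).1 (θb_mem q.1).1

/-- **(iii): `-1.04 ε² ≤ v_z ≤ 1`** (printed: `-ε² ≤ v₂₁ ≤ 1`). [cite: Ozanski2017NSISingular, Lemma 5.2 (iii)] -/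
theorem field_snd_mem (hε : 0 < ε) (hr : 0 < r) (q : ℝ × ℝ) :
    (field ε r d q).2 ∈ Icc (-(104 / 100 * ε ^ 2)) 1 := by
  have hP := P_mem (r := r) (d := d) q.2
  have hb := θb_mem (ε := ε) (r := r) q.1
  have ht := θt_mem (r := r) q.1
  have hl0 := lam_nonneg hε hr
  have hl1 := lam_le hε hr
  simp only [field, g, mem_Icc]
  constructor
  · have h1 : lam ε r * θt r q.1 ≤ 104 / 100 * ε ^ 2 := by nlinarith [hl1, ht.2, ht.1]
    nlinarith [hP.1, hP.2, hb.1, mul_nonneg hl0 ht.1]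
  · nlinarith [hP.1, hP.2, hb.1, hb.2, mul_nonneg hl0 ht.1]

/-- **(iii): `|v_r| ≤ K ε`** for an absolute constant (printed: `|v₂₂| < ε/2`):
`|v_r| = |P'(z)| |Q(ρ)/ρ| ≤ (2.5K_S/r)(49 εr)`. [cite: Ozanski2017NSISingular, Lemma 5.2 (iii)] -/
theorem abs_field_fst_le {K : ℝ} (hK : ∀ x, |deriv smoothTransition x| ≤ K) (hε : 0 < ε)
    (hε' : ε ≤ 1 / 20) (hr : 0 < r) (q : ℝ × ℝ) : |(field ε r d q).1| ≤ 123 * K * ε := by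
  have hK0 : 0 ≤ K := (abs_nonneg _).trans (hK 0)
  have h1 := abs_deriv_P_le (d := d) hK hr q.2
  have h2 := abs_Q_mul_inv_le hε hε' hr q.1
  rw [show (field ε r d q).1 = -deriv (P r d) q.2 * (Q ε r q.1 * q.1⁻¹) from rfl, abs_mul, abs_neg]
  calc |deriv (P r d) q.2| * |Q ε r q.1 * q.1⁻¹| ≤ 5 / 2 * K / r * (49 * (ε * r)) :=
        mul_le_mul h1 h2 (abs_nonneg _) (by positivity)
    _ = 245 / 2 * K * ε := by field_simp; ring
    _ ≤ 123 * K * ε := by nlinarith [mul_nonneg hK0 hε.le]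

end Estimates

end RingField

/-! ### Lemma 5.2 -/

/-- **Ożański 2017, Lemma 5.2 (the field `v₂`)**, in the form consumed by the geometric
arrangement (tree coordinates `q = (r,z)`, `v = (v_r, v_z)`): there is an absolute constant
`K > 0` such that for all `0 < ε ≤ 1/20`, `r > 0`, `d ∈ ℝ` the field `v₂ = RingField.field ε r d`
satisfies: `v₂ ∈ C^∞`; **(i)** `div(r v₂) = 0`; **(ii)**
`supp v₂ ⊆ (0.005εr, r) × (-d, d) ∖ [εr, r/10] × [-(d-r), d-r]`; **(iv)** `v₂ = (0, 1)` (unit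
axial flow) for `|z| ≤ d - r`, `0.02εr ≤ ρ ≤ 0.98εr`; **(iii)** `v_r = 0` for `|z| ≤ d - r`,
`v_z ≥ 0` for `ρ ≤ 0.11 r`, `-1.04ε² ≤ v_z ≤ 1` and `|v_r| ≤ Kε` everywhere (printed:
`v₂₁ ≥ 0, v₂₂ = 0` in `[-(d-r),d-r] × (0,εr)`, `-ε² ≤ v₂₁ ≤ 1`, `|v₂₂| < ε/2`; the `O(ε²)`,
`O(ε)` orders are what §5.4–§5.5 use). [cite: Ozanski2017NSISingular, Lemma 5.2 (i)–(iv)]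
[cite: Scheffer1987, §4 (4.20)–(4.31)] -/
theorem exists_ringField :
    ∃ K : ℝ, 0 < K ∧ ∀ ε r d : ℝ, 0 < ε → ε ≤ 1 / 20 → 0 < r →
      ContDiff ℝ ∞ (RingField.field ε r d) ∧
      (∀ q : ℝ × ℝ, derivR (fun q' : ℝ × ℝ => q'.1 * (RingField.field ε r d q').1) q +
        derivZ (fun q' : ℝ × ℝ => q'.1 * (RingField.field ε r d q').2) q = 0) ∧
      tsupport (RingField.field ε r d) ⊆
        rect (ε * r / 200) r (-d) d \ crect (ε * r) (r / 10) (-(d - r)) (d - r) ∧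
      (∀ q : ℝ × ℝ, |q.2| ≤ d - r → q.1 ∈ Icc (2 * ε * r / 100) (98 * ε * r / 100) →
        RingField.field ε r d q = (0, 1)) ∧
      (∀ q : ℝ × ℝ, |q.2| ≤ d - r → (RingField.field ε r d q).1 = 0) ∧
      (∀ q : ℝ × ℝ, q.1 ≤ 11 * r / 100 → 0 ≤ (RingField.field ε r d q).2) ∧
      (∀ q : ℝ × ℝ, (RingField.field ε r d q).2 ∈ Icc (-(104 / 100 * ε ^ 2)) 1) ∧
      (∀ q : ℝ × ℝ, |(RingField.field ε r d q).1| ≤ K * ε) := by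
  obtain ⟨K, hK0, hK⟩ := exists_abs_deriv_smoothTransition_le
  refine ⟨123 * K + 1, by positivity, fun ε r d hε hε' hr => ⟨RingField.contDiff_field hε hε' hr,
    RingField.div_field hε hε' hr, RingField.tsupport_field_subset hε hε' hr,
    fun q hz hρ => RingField.field_eq_of_mem_rect hε hε' hr hz hρ,
    fun q hz => RingField.field_fst_eq_zero hr hz, fun q hρ => RingField.field_snd_nonneg hr hρ,
    fun q => RingField.field_snd_mem hε hr q, fun q => ?_⟩⟩
  calc |(RingField.field ε r d q).1| ≤ 123 * K * ε := RingField.abs_field_fst_le hK hε hε' hr q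
    _ ≤ (123 * K + 1) * ε := by nlinarith


end Literature.Barriers.NavierStokesRegularity
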